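import Literature.AnabelianGeometry.AbsoluteAnabelian.AbsTopIII.Reconstruction
import HarnessLib

/-!
# [AbsTopIII] Thm. 1.9 / Cor. 1.10 (iii) relative to a model: what the instance forms ENTAIL
# (bi-anabelian rigidity of the model's fields; factorisation of the point data through `Π`)

S. Mochizuki, *Topics in Absolute Anabelian Geometry III: global reconstruction algorithms*
[MochizukiAbsTopIII2015], Thm. 1.9 pp. 37–38, Cor. 1.10 (iii) pp. 43–44, Rmk. 1.9.5 (i) p. 39
(the bi-anabelian corollary: an isomorphism `Π_X ≅ Π_Y` of extensions induces an isomorphism of the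
reconstructed NF-function fields), Rmk. 1.9.8 pp. 40–41 (mono- versus bi-anabelian), Rmk. 1.9.4
pp. 38–39 (`G_k` alone does NOT determine the MLF `k`; `Π_X` does, via Cor. 1.10 (iii)(h)).
Cell abc-iut, block F (fact-proving wave), seat abc-iut-f-088 (gen 4; FACT-LIST tranche 88 =
F-0394 · F-0395 · F-0396 · F-0399); PROOF-ONLY companion of `AbsTopIII/Reconstruction.lean`
(abc-iut-L4-t1; imported, never edited): no `def`, no `instance`, no `structure`, no `Prop` fact.

THE ROWS.  `AbsTopIII.Thm_1_9 M` (F-0399) and `AbsTopIII.Cor_1_10_iii M` (F-0396) are NAMED FACTS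
RELATIVE TO an interface `M : CurveModel`: "SOME functorial group-theoretic algorithm record
(`NFPortionAlgorithm` / `MLFReconstructionAlgorithm`: outputs on EVERY abstract extension, transport
`map` along isomorphisms of extensions, `comap` along open injective homomorphisms, `comapBase` along
base-change homomorphisms) has the printed output on every input curve of the model".  Record so
far: universal closures over all `M` REFUTED (`ReconstructionSchemaNegative`, gen 0 of this seat);
instance forms jointly SATISFIABLE at a one-curve interface by constant algorithm records
(`ReconstructionFactsNonVacuity`, abc-iut-f-056) — "instance forms open (hypothesis at a coherent
`M`)".

THIS FILE makes precise what binding either row BY NAME at a model `M` commits a consumer to — the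
CONTENT the typed functoriality fields carry, i.e. what any supplier of the instance form must
deliver (and the exact dividing line the gen-0 countermodels sit on):

* `Thm_1_9.nonempty_ringEquiv_nfFunctionField` — under `Thm_1_9 M`, two Thm-1.9 inputs `X`, `Y`
  whose extensions are ISOMORPHIC (`M.ext X ≅ M.ext Y` in the category of extensions) have
  isomorphic NF-function fields `K_{Z_X,NF} ≃+* K_{Z_Y,NF}` (transport through `A.map`): the
  bi-anabelian statement of Rmk. 1.9.5 (i) for the model; `…_kbarNF` the same for `k̄_NF`;
  `Thm_1_9.nonempty_ringHom_nfFunctionField_of_isOpenInjective` / `…_of_isBaseChange` — an open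
  injective (resp. base-change) homomorphism `Π_X → Π_Y` of input extensions yields a field
  embedding `K_{Z_Y,NF} →+* K_{Z_X,NF}` (through `A.comap` / `A.comapBase`);
  `Thm_1_9.exists_nfPointDecomp_eq` — the (a)-data "decomposition groups of NF-points up to
  conjugacy" FACTOR through `X ↦ M.ext X` (one set-valued function on abstract extensions).
* `Cor_1_10_iii.exists_ringEquiv_compatible` — under `Cor_1_10_iii M`, two strictly-Belyi inputs
  over MLF's with isomorphic extensions have isomorphic PAIRS `k_X ⊆ K_X`, `k_Y ⊆ K_Y`, compatibly
  with the inclusions; in particular (`Cor_1_10_iii.nonempty_ringEquiv_base`) isomorphic `Π`'s force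
  isomorphic base MLF's — non-trivial in print, since `G_k` alone does not determine `k` (Rmk. 1.9.4,
  [AbsTopI] Cor. 3.7) — and (`…_functionField`) isomorphic function fields;
  `Cor_1_10_iii.nonempty_ringHom_functionField_of_isOpenInjective`;
  `Cor_1_10_iii.exists_closedPointDecomp_eq` — the (e)-data factor through `M.ext`.
* REFUTATION SCHEMATA (the general form of gen 0's countermodels): `not_thm_1_9_of_iso_of_isEmpty`
  (two inputs, isomorphic extensions, NO ring isomorphism of NF-function fields ⟹ `¬ Thm_1_9 M`),
  `not_thm_1_9_of_not_exists_nfPointDecomp_eq` (point data not a function of the extension ⟹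
  `¬ Thm_1_9 M`), `not_cor_1_10_iii_of_iso_of_isEmpty_base` / `…_functionField`,
  `not_cor_1_10_iii_of_not_exists_closedPointDecomp_eq`.

HONEST LABEL.  Elementary consequences of OUR typing (the algorithm records' `map` / `comap` /
`comapBase` fields and the per-curve comparison clauses); nothing here proves or refutes either row
at the intended étale-`π₁` model, whose content (Belyi cuspidalization, Kummer classes, Uchida's
lemma, [pGC] Thm. A) stays a named input (plan/FOUNDATIONS.md row 12).  FACT-LIST vocabulary:
F-0399 / F-0396 «∀-closure REFUTED; model-witnessed (toy); instance form ENTAILS bi-anabelian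
rigidity of the model's (NF-)function fields across isomorphic extensions».  Typed ≠ proved; nothing
here bears on the disputed [IUTchIII] Cor. 3.12; no side taken on any author.
-/

noncomputable section

open scoped Classical Pointwise

namespace Literature.AnabelianGeometry.AbsoluteAnabelian.AbsTopIII

open CategoryTheory

universe u

variable {M : CurveModel.{u}}

/-! ### Theorem 1.9: consequences of the instance form `Thm_1_9 M` -/

/-- **Bi-anabelian rigidity of the NF-function field under `Thm_1_9 M`** (Rmk. 1.9.5 (i) for the
model): if some functorial group-theoretic algorithm reconstructs `K_{Z_NF}` on every Thm-1.9 input of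
`M`, then two inputs `X`, `Y` with ISOMORPHIC extensions `(1 → Δ_X → Π_X → G_{k_X} → 1) ≅
(1 → Δ_Y → Π_Y → G_{k_Y} → 1)` have isomorphic NF-function fields — transport the comparison
isomorphisms through the algorithm's `map`. [cite: MochizukiAbsTopIII2015, Thm 1.9 p.37] -/
theorem Thm_1_9.nonempty_ringEquiv_nfFunctionField (h : Thm_1_9 M) {X Y : M.Curve}
    (hX : M.IsThm19Input X) (hY : M.IsThm19Input Y) (e : M.ext X ≅ M.ext Y) :
    Nonempty (M.NFFunctionField X ≃+* M.NFFunctionField Y) := by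
  obtain ⟨A, hA⟩ := h
  obtain ⟨φX⟩ := (hA X hX).2.2
  obtain ⟨φY⟩ := (hA Y hY).2.2
  exact ⟨φX.symm.trans ((A.map e).funEquiv.trans φY)⟩

/-- Under `Thm_1_9 M`, two Thm-1.9 inputs with isomorphic extensions have isomorphic "`k̄_NF`"
(step (e), first field; mathematically automatic — both are algebraic closures of `ℚ` — but recorded
as the shape the `constEquiv` component of `A.map` delivers). [cite: MochizukiAbsTopIII2015, Thm 1.9 (e) p.38] -/
theorem Thm_1_9.nonempty_ringEquiv_kbarNF (h : Thm_1_9 M) {X Y : M.Curve}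
    (hX : M.IsThm19Input X) (hY : M.IsThm19Input Y) (e : M.ext X ≅ M.ext Y) :
    Nonempty (M.kbarNF X ≃+* M.kbarNF Y) := by
  obtain ⟨A, hA⟩ := h
  obtain ⟨φX⟩ := (hA X hX).2.1
  obtain ⟨φY⟩ := (hA Y hY).2.1
  exact ⟨φX.symm.trans ((A.map e).constEquiv.trans φY)⟩

/-- **Relative rigidity under `Thm_1_9 M`, open injections** ("the asserted 'functoriality' is with
respect to arbitrary open injective homomorphisms of extensions of profinite groups", p. 38): an
open injective homomorphism `Π_X ↪ Π_Y` between the extensions of two Thm-1.9 inputs yields a field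
embedding `K_{Z_Y,NF} ↪ K_{Z_X,NF}` (contravariant; through `A.comap`).
[cite: MochizukiAbsTopIII2015, Thm 1.9 p.38] -/
theorem Thm_1_9.nonempty_ringHom_nfFunctionField_of_isOpenInjective (h : Thm_1_9 M)
    {X Y : M.Curve} (hX : M.IsThm19Input X) (hY : M.IsThm19Input Y) (f : M.ext X ⟶ M.ext Y)
    (hf : f.IsOpenInjective) : Nonempty (M.NFFunctionField Y →+* M.NFFunctionField X) := by
  obtain ⟨A, hA⟩ := h
  obtain ⟨φX⟩ := (hA X hX).2.2
  obtain ⟨φY⟩ := (hA Y hY).2.2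
  exact ⟨(φX.toRingHom.comp (A.comap f hf)).comp φY.symm.toRingHom⟩

/-- **Relative rigidity under `Thm_1_9 M`, base change** ("as well as with respect to homomorphisms
of extensions of profinite groups arising from a base-change of the base field", p. 38): a
base-change homomorphism `Π_X → Π_Y` between the extensions of two Thm-1.9 inputs yields a field
embedding `K_{Z_Y,NF} ↪ K_{Z_X,NF}` (through `A.comapBase`). [cite: MochizukiAbsTopIII2015, Thm 1.9 p.38] -/
theorem Thm_1_9.nonempty_ringHom_nfFunctionField_of_isBaseChange (h : Thm_1_9 M)
    {X Y : M.Curve} (hX : M.IsThm19Input X) (hY : M.IsThm19Input Y) (f : M.ext X ⟶ M.ext Y)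
    (hf : f.IsBaseChange) : Nonempty (M.NFFunctionField Y →+* M.NFFunctionField X) := by
  obtain ⟨A, hA⟩ := h
  obtain ⟨φX⟩ := (hA X hX).2.2
  obtain ⟨φY⟩ := (hA Y hY).2.2
  exact ⟨(φX.toRingHom.comp (A.comapBase f hf)).comp φY.symm.toRingHom⟩

/-- **The (a)-data factor through `Π` under `Thm_1_9 M`**: there is ONE assignment `S` of a set of
closed subgroups to every abstract extension such that, on every Thm-1.9 input `X`, the set of
conjugates of decomposition groups of NF-points of `X` IS `S (M.ext X)` — in particular two inputs
with the SAME extension have the same NF-point decomposition data (the shape violated by the gen-0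
countermodels `Thm_1_9.exists_countermodel_decomp`). [cite: MochizukiAbsTopIII2015, Thm 1.9 (a) p.37] -/
theorem Thm_1_9.exists_nfPointDecomp_eq (h : Thm_1_9 M) :
    ∃ S : ∀ E : FundamentalExtension.{u}, Set (Subgroup E.arith),
      ∀ X : M.Curve, M.IsThm19Input X →
        {D | ∃ (x : M.Point X) (g : (M.ext X).arith),
            M.IsNFPoint X x ∧ D = MulAut.conj g • M.decomp X x} = S (M.ext X) := by
  obtain ⟨A, hA⟩ := h
  exact ⟨fun E => (A.obj E).nfPointDecomp, fun X hX => ((hA X hX).1).symm⟩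

/-- **Refutation schema for `Thm_1_9 M` (fields)**: two Thm-1.9 inputs with isomorphic extensions
but NO ring isomorphism between their NF-function fields refute the instance form at `M` (the
general form of `Thm_1_9.exists_countermodel_functionField`, gen 0: `K_{Z_NF} = ℚ` versus `ℚ̄` on
one shared extension). [cite: MochizukiAbsTopIII2015, Thm 1.9 p.37] -/
theorem not_thm_1_9_of_iso_of_isEmpty {X Y : M.Curve} (hX : M.IsThm19Input X)
    (hY : M.IsThm19Input Y) (e : M.ext X ≅ M.ext Y)
    (hXY : IsEmpty (M.NFFunctionField X ≃+* M.NFFunctionField Y)) :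
    ¬ Literature.AnabelianGeometry.AbsoluteAnabelian.AbsTopIII.Thm_1_9 M := fun h =>
  hXY.false (h.nonempty_ringEquiv_nfFunctionField hX hY e).some

/-- **Refutation schema for `Thm_1_9 M` (points)**: if the NF-point decomposition data of the
Thm-1.9 inputs of `M` are NOT a function of the extension, the instance form fails at `M` (the
general form of `Thm_1_9.exists_countermodel_decomp`, gen 0: `{Π}` versus `∅` on one shared
extension). [cite: MochizukiAbsTopIII2015, Thm 1.9 (a) p.37] -/
theorem not_thm_1_9_of_not_exists_nfPointDecomp_eq
    (hM : ¬ ∃ S : ∀ E : FundamentalExtension.{u}, Set (Subgroup E.arith),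
      ∀ X : M.Curve, M.IsThm19Input X →
        {D | ∃ (x : M.Point X) (g : (M.ext X).arith),
            M.IsNFPoint X x ∧ D = MulAut.conj g • M.decomp X x} = S (M.ext X)) :
    ¬ Literature.AnabelianGeometry.AbsoluteAnabelian.AbsTopIII.Thm_1_9 M := fun h =>
  hM h.exists_nfPointDecomp_eq

/-! ### Corollary 1.10 (iii): consequences of the instance form `Cor_1_10_iii M` -/

/-- **Bi-anabelian rigidity of `k ⊆ K_X` under `Cor_1_10_iii M`**: if some functorial
group-theoretic algorithm reconstructs the pair "`k^× ∪ {0} ⊆ K_X^× ∪ {0}`" on every strictly-Belyi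
input over an MLF, then two such inputs `X`, `Y` with isomorphic extensions have isomorphic pairs
`k_X ⊆ K_X`, `k_Y ⊆ K_Y`, COMPATIBLY with the inclusions (transport through `A.map`, whose
components commute with `k ⊆ K_X` by `MLFReconstruction.Iso.comm`).
[cite: MochizukiAbsTopIII2015, Cor 1.10 (iii) p.43] -/
theorem Cor_1_10_iii.exists_ringEquiv_compatible (h : Cor_1_10_iii M) {X Y : M.Curve}
    (hX : M.IsCor110Input X) (hXb : M.IsStrictlyBelyiType X) (hY : M.IsCor110Input Y)
    (hYb : M.IsStrictlyBelyiType Y) (e : M.ext X ≅ M.ext Y) :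
    ∃ (eb : M.base X ≃+* M.base Y) (ef : M.FunctionField X ≃+* M.FunctionField Y),
      ∀ c, ef (algebraMap (M.base X) (M.FunctionField X) c) =
        algebraMap (M.base Y) (M.FunctionField Y) (eb c) := by
  obtain ⟨A, hA⟩ := h
  obtain ⟨⟨ebX, efX, hcX⟩, -⟩ := hA X hX hXb
  obtain ⟨⟨ebY, efY, hcY⟩, -⟩ := hA Y hY hYb
  refine ⟨ebX.symm.trans ((A.map e).baseEquiv.trans ebY),
    efX.symm.trans ((A.map e).funEquiv.trans efY), fun c => ?_⟩
  have h₁ : efX.symm (algebraMap (M.base X) (M.FunctionField X) c) =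
      algebraMap _ _ (ebX.symm c) := by
    apply efX.injective
    rw [RingEquiv.apply_symm_apply, hcX, RingEquiv.apply_symm_apply]
  simp only [RingEquiv.trans_apply]
  rw [h₁, (A.map e).comm, hcY]

/-- Under `Cor_1_10_iii M`, two strictly-Belyi inputs over MLF's with isomorphic `Π`'s (as
extensions) have isomorphic BASE FIELDS: "`Π_X` determines the MLF `k`" — non-trivial in print,
since the absolute Galois group `G_k` alone does not (Rmk. 1.9.4 pp. 38–39: one rigid and one
non-rigid dimension; [AbsTopI] Cor. 3.7). [cite: MochizukiAbsTopIII2015, Cor 1.10 (iii) p.43] -/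
theorem Cor_1_10_iii.nonempty_ringEquiv_base (h : Cor_1_10_iii M) {X Y : M.Curve}
    (hX : M.IsCor110Input X) (hXb : M.IsStrictlyBelyiType X) (hY : M.IsCor110Input Y)
    (hYb : M.IsStrictlyBelyiType Y) (e : M.ext X ≅ M.ext Y) :
    Nonempty (M.base X ≃+* M.base Y) := by
  obtain ⟨eb, -, -⟩ := h.exists_ringEquiv_compatible hX hXb hY hYb e
  exact ⟨eb⟩

/-- Under `Cor_1_10_iii M`, two strictly-Belyi inputs over MLF's with isomorphic extensions have
isomorphic function fields `K_X ≃+* K_Y` ("Mochizuki's theorem" in the sense of Scholze–Stix,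
Thm. 7, read bi-anabelially for the model). [cite: MochizukiAbsTopIII2015, Cor 1.10 (iii) p.43] -/
theorem Cor_1_10_iii.nonempty_ringEquiv_functionField (h : Cor_1_10_iii M) {X Y : M.Curve}
    (hX : M.IsCor110Input X) (hXb : M.IsStrictlyBelyiType X) (hY : M.IsCor110Input Y)
    (hYb : M.IsStrictlyBelyiType Y) (e : M.ext X ≅ M.ext Y) :
    Nonempty (M.FunctionField X ≃+* M.FunctionField Y) := by
  obtain ⟨-, ef, -⟩ := h.exists_ringEquiv_compatible hX hXb hY hYb e
  exact ⟨ef⟩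

/-- **Relative rigidity under `Cor_1_10_iii M`** ("'functoriality' is with respect to arbitrary open
injective homomorphisms of profinite groups", p. 44): an open injective homomorphism `Π_X ↪ Π_Y`
between the extensions of two strictly-Belyi inputs over MLF's yields a field embedding
`K_Y ↪ K_X` (through `A.comap`). [cite: MochizukiAbsTopIII2015, Cor 1.10 (iii) p.44] -/
theorem Cor_1_10_iii.nonempty_ringHom_functionField_of_isOpenInjective (h : Cor_1_10_iii M)
    {X Y : M.Curve} (hX : M.IsCor110Input X) (hXb : M.IsStrictlyBelyiType X)
    (hY : M.IsCor110Input Y) (hYb : M.IsStrictlyBelyiType Y) (f : M.ext X ⟶ M.ext Y)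
    (hf : f.IsOpenInjective) : Nonempty (M.FunctionField Y →+* M.FunctionField X) := by
  obtain ⟨A, hA⟩ := h
  obtain ⟨⟨-, efX, -⟩, -⟩ := hA X hX hXb
  obtain ⟨⟨-, efY, -⟩, -⟩ := hA Y hY hYb
  exact ⟨(efX.toRingHom.comp (A.comap f hf)).comp efY.symm.toRingHom⟩

/-- **The (e)-data factor through `Π` under `Cor_1_10_iii M`**: ONE assignment `S` of a set of
closed subgroups to every abstract extension computes, on every strictly-Belyi input `X` over an
MLF, the set of conjugates of the decomposition groups of the closed points of `X` — two inputs with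
the SAME extension have the same closed-point decomposition data (the shape violated by
`Cor_1_10_iii.exists_countermodel_decomp`, gen 0). [cite: MochizukiAbsTopIII2015, Cor 1.10 (iii) p.43] -/
theorem Cor_1_10_iii.exists_closedPointDecomp_eq (h : Cor_1_10_iii M) :
    ∃ S : ∀ E : FundamentalExtension.{u}, Set (Subgroup E.arith),
      ∀ X : M.Curve, M.IsCor110Input X → M.IsStrictlyBelyiType X →
        {D | ∃ (x : M.Point X) (g : (M.ext X).arith), D = MulAut.conj g • M.decomp X x} =
          S (M.ext X) := by
  obtain ⟨A, hA⟩ := h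
  exact ⟨fun E => (A.obj E).closedPointDecomp, fun X hX hXb => ((hA X hX hXb).2).symm⟩

/-- **Refutation schema for `Cor_1_10_iii M` (base fields)**: two strictly-Belyi inputs over MLF's
with isomorphic extensions but non-isomorphic base fields refute the instance form at `M`.
[cite: MochizukiAbsTopIII2015, Cor 1.10 (iii) p.43] -/
theorem not_cor_1_10_iii_of_iso_of_isEmpty_base {X Y : M.Curve} (hX : M.IsCor110Input X)
    (hXb : M.IsStrictlyBelyiType X) (hY : M.IsCor110Input Y) (hYb : M.IsStrictlyBelyiType Y)
    (e : M.ext X ≅ M.ext Y) (hXY : IsEmpty (M.base X ≃+* M.base Y)) :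
    ¬ Literature.AnabelianGeometry.AbsoluteAnabelian.AbsTopIII.Cor_1_10_iii M := fun h =>
  hXY.false (h.nonempty_ringEquiv_base hX hXb hY hYb e).some

/-- **Refutation schema for `Cor_1_10_iii M` (function fields)**: two strictly-Belyi inputs over
MLF's with isomorphic extensions but non-isomorphic function fields refute the instance form at
`M`. [cite: MochizukiAbsTopIII2015, Cor 1.10 (iii) p.43] -/
theorem not_cor_1_10_iii_of_iso_of_isEmpty_functionField {X Y : M.Curve}
    (hX : M.IsCor110Input X) (hXb : M.IsStrictlyBelyiType X) (hY : M.IsCor110Input Y)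
    (hYb : M.IsStrictlyBelyiType Y) (e : M.ext X ≅ M.ext Y)
    (hXY : IsEmpty (M.FunctionField X ≃+* M.FunctionField Y)) :
    ¬ Literature.AnabelianGeometry.AbsoluteAnabelian.AbsTopIII.Cor_1_10_iii M := fun h =>
  hXY.false (h.nonempty_ringEquiv_functionField hX hXb hY hYb e).some

/-- **Refutation schema for `Cor_1_10_iii M` (points)**: if the closed-point decomposition data of
the strictly-Belyi MLF inputs of `M` are NOT a function of the extension, the instance form fails
at `M` (the general form of `Cor_1_10_iii.exists_countermodel_decomp`, gen 0).
[cite: MochizukiAbsTopIII2015, Cor 1.10 (iii) p.43] -/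
theorem not_cor_1_10_iii_of_not_exists_closedPointDecomp_eq
    (hM : ¬ ∃ S : ∀ E : FundamentalExtension.{u}, Set (Subgroup E.arith),
      ∀ X : M.Curve, M.IsCor110Input X → M.IsStrictlyBelyiType X →
        {D | ∃ (x : M.Point X) (g : (M.ext X).arith), D = MulAut.conj g • M.decomp X x} =
          S (M.ext X)) :
    ¬ Literature.AnabelianGeometry.AbsoluteAnabelian.AbsTopIII.Cor_1_10_iii M := fun h =>
  hM h.exists_closedPointDecomp_eq

end Literature.AnabelianGeometry.AbsoluteAnabelian.AbsTopIII

end
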